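import Summits.AtomisticToContinuum.Crystallization.Theorems.FreeSplittingCertificatesStrictSplittingRuleP1PayNear

/-!
# `StrictSplittingRule` (stmt-AtomisticToContinuum-12560): the JENSEN capacity of a far leg and the midpoint tension from `r ≥ (51/5)‖y_s‖` (P1 interpolant object, part 94)

Route `FreeSplittingCertificates`, crux r3 `StrictSplittingRule` (H12⋆ = `stub_coreJointCoercive`), unit b2b-freesplit-B gen 40.
VALUE = first brick of the SHARPER (B∃) tail lemma.  Part 90 (`farCell_budget`) proves the per-cell readout + defect budget of hypothesis
(B∃) for every cell whose vertices are `≥ 44a` from the base site; below `44a` the budget is certified outside the kernel by TWO engines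
(cellval.py on `rc ≤ 12.3a`, celltail.py on `[11.9a, 45.5a]`, HOME CERT §31/§37).  The `44a` threshold comes from two first-order
pessimisms of parts 84–87: the capacity of a leg was bounded from the SUPREMUM of `|y − y_p|` over the carrier cells (lever arm
`(5/6 + 99/70)a`, factor `(1 + 2.25a/r)⁶`), and the tension lemma asked `r ≥ 12‖y_s‖`.  Here:
* `h1_tau_midpoint10` — the midpoint form of the line-truss tension (part 84) already for `r ≥ (51/5)‖y_s‖`; `h1_tau_midpoint_num18` —
  `τ ≤ (1/12)(133/125)·m⁻⁶` for `r ≥ 89/5` (`‖y_s‖ ≤ 8/5`); `p1Beta_half_le_mid18`, `p1FarW_le_mid18`, `p1FarWv_le_mid18`;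
* `setIntegral_fpSq_sub_le` — `∫_T |y − P|² ≤ (|T|/4)·Σ_m |y_m − P|²` (barycentric Jensen + the first moments `∫_T λ_m = |T|/4`);
* **`p1CellJ_ge_tangent`** — for a cell with a far vertex and ANY `X > 0`: `J_T ≥ |T|X⁻³ − 3X⁻⁴((|T|/4)Σ_m|y_m − y_p|² − |T|X)`
  (the tangent of the convex `s ↦ s⁻³` at `X`, integrated; `χ ≡ 1` on the cell);
* **`cap_ge_carriers_tangent`** — the capacity `Σ_{T' ∋ e} J_{T'}` of a loaded leg is `≥ n|T'|X⁻³` as soon as the MEAN vertex second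
  moment of its `n` tabulated carriers (part 86) is `≤ X`: Jensen twice (over the cell and over the carriers) with ONE tangent point —
  the first-order term in the direction of `y_p` now enters only through the carriers' vertex MEAN (parts 95–96 tabulate it).
NOT a proof of H12⋆, NOT summit progress.  [folklore: Jensen / tangent-line bound for a convex power; P1 first moments]
-/

noncomputable section

open Set Function Metric MeasureTheory Filter Topology
open scoped BigOperators NNReal ENNReal Classical

namespace Summit.AtomisticToContinuum.Crystallization.Theorems.StrictSplittingRuleBirth

open Literature.MathematicalPhysics.StatisticalMechanics
open Summit.AtomisticToContinuum.Crystallization.Theorems.PalmUnimodularRigidity.LayeredLawsSelectHcp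

/-! ## The midpoint tension from `r ≥ (51/5)‖y_s‖` -/

section Tau5

variable {a h : ℝ} {V : Bool → ℤ × ℤ × ℤ → EuclideanSpace ℝ (Fin 3)} {F : Bool → (ℤ × ℤ × ℤ) → (ℤ × ℤ × ℤ) → ℤ → ℝ}
  {τ : Bool → (ℤ × ℤ × ℤ) → (ℤ × ℤ × ℤ) → ℝ}

/-- **The midpoint form of the tension, both orientations, from `r ≥ (51/5)‖y_s‖`** (part 84's `h1_tau_midpoint` asked `r ≥ 12‖y_s‖`; its
only use of that hypothesis, `¼P + (7/4)E² ≤ r²/24`, already holds from `r ≥ 10.2E`):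
`τ c s d ≤ (1/12)·(‖v + ½y_s‖²)⁻³ + ½‖y_s‖²·r⁻⁸`. [folklore] -/
theorem h1_tau_midpoint10 (ha : 0 < a) (hh : 0 < h)
    (hV : ∀ c d, V c d = if c = true then hcpSite a h d else -hcpSite a h (-d))
    (hF : ∀ c s d n, F c s d n =
      ljSqDeriv (‖V c (d + n • s)‖ ^ 2) * inner ℝ (V c (d + n • s)) (hcpSite a h s))
    (hτ : ∀ c s d, τ c s d = if 0 ≤ inner ℝ (V c d) (hcpSite a h s) then ∑' m : ℕ, F c s d ((m : ℤ) + 1)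
      else -(F c s d 0 + ∑' m : ℕ, F c s d (-((m : ℤ) + 1))))
    (c : Bool) {s : ℤ × ℤ × ℤ} (hs : s ∈ ({(0, 1, 0), (0, 0, 1), (0, -1, 1), (2, 0, 0)} : Finset (ℤ × ℤ × ℤ)))
    {d : ℤ × ℤ × ℤ} (hd : d ≠ 0) (hr : 51 / 5 * ‖hcpSite a h s‖ ≤ ‖V c d‖) :
    τ c s d ≤ 1 / 12 * ((‖V c d + (1 / 2 : ℝ) • hcpSite a h s‖ ^ 2)⁻¹) ^ 3 +
      1 / 2 * ‖hcpSite a h s‖ ^ 2 * (‖V c d‖⁻¹) ^ 8 := by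
  have h2 := h1_tau_asymp2 ha hh hV hF hτ c hs hd
  set e := hcpSite a h s with he_def
  set v := V c d with hv_def
  set r := ‖v‖ with hr_def
  set E := ‖e‖ with hE_def
  set P := inner ℝ v e with hP_def
  have hρ : 0 < min a h := lt_min ha hh
  have hr0 : 0 < r := hρ.trans_le (h1_V_norm_ge ha hh hV c hd)
  have hE0 : 0 ≤ E := norm_nonneg _
  have hPle : P ≤ r * E := real_inner_le_norm v e
  have hPge : -(r * E) ≤ P := by
    have := real_inner_le_norm v (-e)
    rw [inner_neg_right, norm_neg] at this
    linarith
  have hm2 : ‖v + (1 / 2 : ℝ) • e‖ ^ 2 = r ^ 2 + P + 1 / 4 * E ^ 2 := by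
    rw [h1_line_norm_sq]; ring
  have hm0 : 0 < ‖v + (1 / 2 : ℝ) • e‖ ^ 2 := by
    rw [hm2]; nlinarith
  have hup : τ c s d ≤ -(1 / 2 * lennardJones r) - 1 / 2 * (ljSqDeriv (r ^ 2) * P) +
      (14 + 56 * (r⁻¹) ^ 6) / 32 * (E ^ 2 * (r⁻¹) ^ 8) := by
    have := (abs_le.mp h2).2; linarith
  have htan := inv_cube_tangent hm0 (by positivity : (0 : ℝ) < r ^ 2)
  rw [hm2] at htan ⊢
  have hid1 : ((r ^ 2)⁻¹) ^ 3 - 3 * ((r ^ 2)⁻¹) ^ 4 * (r ^ 2 + P + 1 / 4 * E ^ 2 - r ^ 2) =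
      (r⁻¹) ^ 6 - 3 * (r⁻¹) ^ 8 * P - 3 / 4 * E ^ 2 * (r⁻¹) ^ 8 := by
    rw [inv_pow, inv_pow, ← pow_mul, ← pow_mul, inv_pow, inv_pow]; ring
  rw [hid1] at htan
  have hjunk : -(1 / 2 * lennardJones r) - 1 / 2 * (ljSqDeriv (r ^ 2) * P) + (14 + 56 * (r⁻¹) ^ 6) / 32 * (E ^ 2 * (r⁻¹) ^ 8) ≤
      1 / 12 * ((r⁻¹) ^ 6 - 3 * (r⁻¹) ^ 8 * P - 3 / 4 * E ^ 2 * (r⁻¹) ^ 8) + 1 / 2 * E ^ 2 * (r⁻¹) ^ 8 := by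
    have hrE : 0 ≤ r - 51 / 5 * E := by linarith
    have hkey : 1 / 4 * P + 7 / 4 * E ^ 2 ≤ r ^ 2 / 24 := by
      nlinarith [mul_nonneg hrE hE0, mul_nonneg hrE hrE, mul_nonneg hrE hr0.le]
    have hx0 : 0 ≤ (r⁻¹) ^ 14 := by positivity
    have hm := mul_le_mul_of_nonneg_left hkey hx0
    have hid : -(1 / 2 * lennardJones r) - 1 / 2 * (ljSqDeriv (r ^ 2) * P) + (14 + 56 * (r⁻¹) ^ 6) / 32 * (E ^ 2 * (r⁻¹) ^ 8) -
        (1 / 12 * ((r⁻¹) ^ 6 - 3 * (r⁻¹) ^ 8 * P - 3 / 4 * E ^ 2 * (r⁻¹) ^ 8) + 1 / 2 * E ^ 2 * (r⁻¹) ^ 8) =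
        (r⁻¹) ^ 14 * (1 / 4 * P + 7 / 4 * E ^ 2) - (r⁻¹) ^ 14 * (r ^ 2 / 24) := by
      rw [lennardJones, ljSqDeriv]
      field_simp
      ring
    linarith [hid, hm]
  linarith [hup, hjunk, htan]

/-- **Numerical midpoint form from `r ≥ 89/5`**: for `r = ‖V c d‖ ≥ 89/5` and `‖y_s‖ ≤ 8/5`: `τ c s d ≤ (1/12)(133/125)·(‖v + ½y_s‖²)⁻³`
(the second-order remainder `6(E/r)²(1 + E/(2r))⁶ ≤ 8/125`). [folklore] -/
theorem h1_tau_midpoint_num18 (ha : 0 < a) (hh : 0 < h)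
    (hV : ∀ c d, V c d = if c = true then hcpSite a h d else -hcpSite a h (-d))
    (hF : ∀ c s d n, F c s d n =
      ljSqDeriv (‖V c (d + n • s)‖ ^ 2) * inner ℝ (V c (d + n • s)) (hcpSite a h s))
    (hτ : ∀ c s d, τ c s d = if 0 ≤ inner ℝ (V c d) (hcpSite a h s) then ∑' m : ℕ, F c s d ((m : ℤ) + 1)
      else -(F c s d 0 + ∑' m : ℕ, F c s d (-((m : ℤ) + 1))))
    (c : Bool) {s : ℤ × ℤ × ℤ} (hs : s ∈ ({(0, 1, 0), (0, 0, 1), (0, -1, 1), (2, 0, 0)} : Finset (ℤ × ℤ × ℤ)))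
    {d : ℤ × ℤ × ℤ} (hd : d ≠ 0) (hys : ‖hcpSite a h s‖ ≤ 8 / 5) (hr : 89 / 5 ≤ ‖V c d‖) :
    τ c s d ≤ 1 / 12 * (133 / 125) * ((‖V c d + (1 / 2 : ℝ) • hcpSite a h s‖ ^ 2)⁻¹) ^ 3 := by
  set e := hcpSite a h s with he_def
  set v := V c d with hv_def
  set r := ‖v‖ with hr_def
  set E := ‖e‖ with hE_def
  have hE0 : 0 ≤ E := norm_nonneg _
  have hr0 : 0 < r := lt_of_lt_of_le (by norm_num) hr
  have h10 : 51 / 5 * E ≤ r := by linarith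
  have hmid := h1_tau_midpoint10 ha hh hV hF hτ c hs hd h10
  set P := inner ℝ v e with hP_def
  have hPle : P ≤ r * E := real_inner_le_norm v e
  have hm2 : ‖v + (1 / 2 : ℝ) • e‖ ^ 2 = r ^ 2 + P + 1 / 4 * E ^ 2 := by
    rw [h1_line_norm_sq]; ring
  have hPge : -(r * E) ≤ P := by
    have := real_inner_le_norm v (-e)
    rw [inner_neg_right, norm_neg] at this
    linarith
  have hm0 : 0 < ‖v + (1 / 2 : ℝ) • e‖ ^ 2 := by rw [hm2]; nlinarith
  have hmle : ‖v + (1 / 2 : ℝ) • e‖ ^ 2 ≤ (r + E / 2) ^ 2 := by rw [hm2]; nlinarith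
  have ht : E / r ≤ 8 / 89 := by rw [div_le_iff₀ hr0]; linarith
  have ht0 : 0 ≤ E / r := by positivity
  have hpoly : (E / r) ^ 2 * (1 + E / r / 2) ^ 6 ≤ 4 / 375 := by
    calc (E / r) ^ 2 * (1 + E / r / 2) ^ 6 ≤ (8 / 89 : ℝ) ^ 2 * (1 + 8 / 89 / 2) ^ 6 := by gcongr
      _ ≤ 4 / 375 := by norm_num
  have hkey : E ^ 2 * (r⁻¹) ^ 8 * (r + E / 2) ^ 6 ≤ 4 / 375 := by
    have hid : E ^ 2 * (r⁻¹) ^ 8 * (r + E / 2) ^ 6 = (E / r) ^ 2 * (1 + E / r / 2) ^ 6 := by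
      have hr' : r ≠ 0 := hr0.ne'
      rw [div_eq_mul_inv E r, inv_eq_one_div]
      field_simp
    rw [hid]; exact hpoly
  have hinv : ((‖v + (1 / 2 : ℝ) • e‖ ^ 2)⁻¹) ^ 3 * (r + E / 2) ^ 6 ≥ 1 := by
    have h3 : (‖v + (1 / 2 : ℝ) • e‖ ^ 2) ^ 3 ≤ ((r + E / 2) ^ 2) ^ 3 := by gcongr
    have h4 : ((r + E / 2) ^ 2) ^ 3 = (r + E / 2) ^ 6 := by ring
    rw [h4] at h3
    have h5 : ((‖v + (1 / 2 : ℝ) • e‖ ^ 2)⁻¹) ^ 3 * (‖v + (1 / 2 : ℝ) • e‖ ^ 2) ^ 3 = 1 := by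
      rw [← mul_pow, inv_mul_cancel₀ hm0.ne', one_pow]
    calc (1 : ℝ) = ((‖v + (1 / 2 : ℝ) • e‖ ^ 2)⁻¹) ^ 3 * (‖v + (1 / 2 : ℝ) • e‖ ^ 2) ^ 3 := h5.symm
      _ ≤ ((‖v + (1 / 2 : ℝ) • e‖ ^ 2)⁻¹) ^ 3 * (r + E / 2) ^ 6 := by gcongr
  have hX0 : 0 ≤ ((‖v + (1 / 2 : ℝ) • e‖ ^ 2)⁻¹) ^ 3 := by positivity
  have hfin : 1 / 2 * E ^ 2 * (r⁻¹) ^ 8 ≤ 1 / 12 * (8 / 125) * ((‖v + (1 / 2 : ℝ) • e‖ ^ 2)⁻¹) ^ 3 := by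
    have h6 := mul_le_mul_of_nonneg_left hkey hX0
    have h7 : 0 ≤ E ^ 2 * (r⁻¹) ^ 8 := by positivity
    nlinarith [mul_le_mul_of_nonneg_left hinv h7]
  linarith [hmid, hfin]

end Tau5

/-- **`½β ≤ (λ_s/24)(133/125)·m⁻⁶` for the named line-truss design from `‖y_q − y_p‖ ≥ 89/5`** (box `a ≤ 8/5`, `h ≤ 4/5`):
`½·p1Beta(b_q)(p − q)(s) ≤ (p1TrussLam s/24)(133/125)·(m²)⁻³`, `m² = ‖(y_q − y_p) + ½y_s‖²`.  NOT a proof of H12⋆, NOT summit progress. [folklore] -/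
theorem p1Beta_half_le_mid18 {a h : ℝ} (ha : 0 < a) (hh : 0 < h) (ha' : a ≤ 8 / 5) (hh' : h ≤ 4 / 5) (p q : ℤ × ℤ × ℤ)
    {s : ℤ × ℤ × ℤ} (hs : s ∈ p1Stencil) (hqp : q ≠ p) (hr : 89 / 5 ≤ ‖hcpSite a h q - hcpSite a h p‖) :
    1 / 2 * p1Beta a h (decide (Even q.1)) (p - q) s ≤
      p1TrussLam a h s / 24 * (133 / 125) * ((‖(hcpSite a h q - hcpSite a h p) + (1 / 2 : ℝ) • hcpSite a h s‖ ^ 2)⁻¹) ^ 3 := by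
  rw [p1Beta_of_mem a h _ _ _ hs]
  have hpar : (if Even (p - q).1 then decide (Even q.1) else !decide (Even q.1)) = decide (Even p.1) := by
    show (if Even (p.1 - q.1) then _ else _) = _
    by_cases hp : Even p.1 <;> by_cases hq : Even q.1 <;> simp [hp, hq, Int.even_sub]
  have hcov : p1TrussV a h (decide (Even p.1)) (q - p) = hcpSite a h q - hcpSite a h p := by
    have := h1_sub_eq a h p (q - p)
    rw [add_sub_cancel] at this
    rw [this, p1TrussV_eq]
    simp
  have hd : q - p ≠ 0 := sub_ne_zero.2 hqp
  have hys := norm_p1Stencil_le ha hh ha' hh' hs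
  have hb := h1_tau_midpoint_num18 ha hh (p1TrussV_eq a h) (p1TrussF_eq a h) (p1TrussTau_eq a h) (decide (Even p.1))
    (p1Stencil_eq ▸ hs) hd hys (by rw [hcov]; exact hr)
  rw [hcov] at hb
  rw [hpar, neg_sub]
  have hlam : 0 ≤ p1TrussLam a h s := by rw [p1TrussLam_eq]; split_ifs <;> positivity
  have := mul_le_mul_of_nonneg_left hb hlam
  linarith

/-- The in-layer far share at the midpoint from `‖y_q − y_p‖ ≥ 89/5` (constant `133/125`). [folklore] -/
theorem p1FarW_le_mid18 {a h : ℝ} (ha : 0 < a) (hh : 0 < h) (ha' : a ≤ 8 / 5) (hh' : h ≤ 4 / 5)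
    (φ : Finset ((ℤ × ℤ × ℤ) × (ℤ × ℤ × ℤ))) (p q s : ℤ × ℤ × ℤ) (hs : s ∈ p1Stencil) (hqp : q ≠ p)
    (hr : 89 / 5 ≤ ‖hcpSite a h q - hcpSite a h p‖) :
    p1FarW a h φ p (q, s) ≤
      p1TrussLam a h s / 24 * (133 / 125) * ((‖(hcpSite a h q - hcpSite a h p) + (1 / 2 : ℝ) • hcpSite a h s‖ ^ 2)⁻¹) ^ 3 := by
  have hlam : 0 ≤ p1TrussLam a h s := by rw [p1TrussLam_eq]; split_ifs <;> positivity
  exact p1FarW_le_of φ p (q, s) (by positivity) fun _ _ => p1Beta_half_le_mid18 ha hh ha' hh' p q hs hqp hr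

/-- The vertical far share at the midpoint from `‖y_q − y_p‖ ≥ 89/5` (constant `133/125`). [folklore] -/
theorem p1FarWv_le_mid18 {a h : ℝ} (ha : 0 < a) (hh : 0 < h) (ha' : a ≤ 8 / 5) (hh' : h ≤ 4 / 5)
    (φ : Finset ((ℤ × ℤ × ℤ) × (ℤ × ℤ × ℤ))) (p q : ℤ × ℤ × ℤ) (hqp : q ≠ p) (hr : 89 / 5 ≤ ‖hcpSite a h q - hcpSite a h p‖) :
    p1FarWv a h φ p q ≤
      p1TrussLam a h p1SV / 24 * (133 / 125) * ((‖(hcpSite a h q - hcpSite a h p) + (1 / 2 : ℝ) • hcpSite a h p1SV‖ ^ 2)⁻¹) ^ 3 := by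
  have hlam : 0 ≤ p1TrussLam a h p1SV := by rw [p1TrussLam_eq]; split_ifs <;> positivity
  exact p1FarWv_le_of φ p q (by positivity) fun _ => p1Beta_half_le_mid18 ha hh ha' hh' p q p1SV_mem hqp hr

/-! ## Barycentric Jensen: the second moment of a cell about any point -/

/-- **`∫_T |y − P|² ≤ (|T|/4)·Σ_m |y_m − P|²`** for every real cell `T` and every point `P` (pointwise `|y − P|² ≤ Σ_m λ_m(y)|y_m − P|²`
by the centred identity of part 44, then the first moments `∫_T λ_m = |T|/4`). [folklore] -/
theorem setIntegral_fpSq_sub_le {a h : ℝ} (ha : 0 < a) (hh : 0 < h) (i : (ℤ × ℤ × ℤ) × Fin 6) (P : Fin 3 → ℝ) :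
    ∫ y in p1RealCell a h i, fpSq (y - P) ≤
      √3 * a ^ 2 * h / 48 * ∑ m : Fin 4, fpSq (fun k => hcpSite a h (i.1 + p1VertOff (p1Par i.1) i.2 m) k - P k) := by
  have hK := isCompact_p1RealCell ha.ne' hh.ne' i
  have hmeas : MeasurableSet (p1RealCell a h i) := (isClosed_p1RealCell a h i).measurableSet
  set c : Fin 4 → ℝ := fun m => fpSq (fun k => hcpSite a h (i.1 + p1VertOff (p1Par i.1) i.2 m) k - P k) with hc
  have hpt : ∀ y ∈ p1RealCell a h i, fpSq (y - P) ≤ ∑ m : Fin 4, c m * p1Lam a h i m y := by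
    intro y hy
    have hid := sum_p1Lam_mul_fpSq_sub ha.ne' hh.ne' hy P
    have hnn : 0 ≤ ∑ m : Fin 4, p1Lam a h i m y * fpSq (fun k => hcpSite a h (i.1 + p1VertOff (p1Par i.1) i.2 m) k - y k) :=
      Finset.sum_nonneg fun m _ => mul_nonneg (p1Lam_nonneg_of_mem hy m) (by unfold fpSq; positivity)
    have hyP : fpSq (y - P) = fpSq (fun k => y k - P k) := rfl
    rw [hyP]
    have hcomm : ∑ m : Fin 4, c m * p1Lam a h i m y =
        ∑ m : Fin 4, p1Lam a h i m y * fpSq (fun k => hcpSite a h (i.1 + p1VertOff (p1Par i.1) i.2 m) k - P k) :=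
      Finset.sum_congr rfl fun m _ => by rw [hc, mul_comm]
    rw [hcomm]
    linarith
  have hintL : IntegrableOn (fun y : Fin 3 → ℝ => fpSq (y - P)) (p1RealCell a h i) volume := by
    have : Continuous fun y : Fin 3 → ℝ => fpSq (y - P) := by unfold fpSq; fun_prop
    exact this.continuousOn.integrableOn_compact hK
  have hintR : IntegrableOn (fun y : Fin 3 → ℝ => ∑ m : Fin 4, c m * p1Lam a h i m y) (p1RealCell a h i) volume := by
    have : Continuous fun y : Fin 3 → ℝ => ∑ m : Fin 4, c m * p1Lam a h i m y :=
      continuous_finsetSum _ fun m _ => continuous_const.mul (continuous_p1Lam a h i m)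
    exact this.continuousOn.integrableOn_compact hK
  have hmono := setIntegral_mono_on hintL hintR hmeas hpt
  have hR : ∫ y in p1RealCell a h i, ∑ m : Fin 4, c m * p1Lam a h i m y = √3 * a ^ 2 * h / 48 * ∑ m : Fin 4, c m := by
    rw [integral_finsetSum _ (fun m _ => ((continuous_p1Lam a h i m).continuousOn.integrableOn_compact hK).const_mul _)]
    simp only [integral_const_mul, setIntegral_p1Lam ha hh, Finset.mul_sum]
    exact Finset.sum_congr rfl fun m _ => by ring
  rw [hR] at hmono
  exact hmono

/-! ## The tangent (Jensen) lower bound of a cell's capacity integral -/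

/-- **`J_T ≥ |T|X⁻³ − 3X⁻⁴·((|T|/4)Σ_m|y_m − y_p|² − |T|X)` for ANY `X > 0`**, for a cell `T = (z − o, π)` with a vertex `z` at distance
`≥ 27a/5 + ϱ` from `y_p` (`χ ≡ 1` on the cell; the tangent `s⁻³ ≥ X⁻³ − 3X⁻⁴(s − X)` of the convex `s ↦ s⁻³`, integrated, and
`setIntegral_fpSq_sub_le`).  With `X` = the mean vertex second moment this is Jensen's `J_T ≥ |T|·X⁻³`. [folklore] -/
theorem p1CellJ_ge_tangent {a h : ℝ} (ha : 0 < a) (hh : 0 < h) (p z : ℤ × ℤ × ℤ) {o : ℤ × ℤ × ℤ} (ho : o ∈ p1Corners)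
    {π : Fin 6} {m : Fin 4} (hv : p1VertOff (p1Par (z - o)) π m = o)
    (hR : 27 / 5 * a + √(4 * a ^ 2 / 3 + h ^ 2) ≤ ‖hcpSite a h z - hcpSite a h p‖) {X : ℝ} (hX : 0 < X) :
    √3 * a ^ 2 * h / 12 * (X⁻¹) ^ 3 - 3 * (X⁻¹) ^ 4 *
        (√3 * a ^ 2 * h / 48 * ∑ m' : Fin 4, fpSq (fun k => hcpSite a h ((z - o) + p1VertOff (p1Par (z - o)) π m') k - hcpSite a h p k) -
          √3 * a ^ 2 * h / 12 * X) ≤ p1CellJ a h p (z - o, π) := by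
  set R := ‖hcpSite a h z - hcpSite a h p‖ with hR_def
  set ϱ := √(4 * a ^ 2 / 3 + h ^ 2) with hϱ_def
  have hϱ0 : 0 ≤ ϱ := Real.sqrt_nonneg _
  have hR0 : 0 ≤ R := norm_nonneg _
  have hϱR : ϱ ≤ R := by nlinarith
  have hS12 : (81 / 20 * a) ^ 2 < (27 / 5 * a) ^ 2 := by nlinarith
  set d : Fin 3 → ℝ := fun k => hcpSite a h z k - hcpSite a h p k with hd_def
  have hd : fpSq d = R ^ 2 := by rw [hR_def, norm_sq_eq_three]; simp [fpSq, hd_def]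
  set T : (ℤ × ℤ × ℤ) × Fin 6 := (z - o, π) with hT
  set P : Fin 3 → ℝ := fun k => hcpSite a h p k with hP
  have hK := isCompact_p1RealCell ha.ne' hh.ne' T
  have hmeas : MeasurableSet (p1RealCell a h T) := (isClosed_p1RealCell a h T).measurableSet
  have hvol := volume_p1RealCell ha hh T
  -- pointwise: `χ = 1`, `s > 0`, tangent inequality
  have hpt : ∀ y ∈ p1RealCell a h T, (X⁻¹) ^ 3 - 3 * (X⁻¹) ^ 4 * (fpSq (y - P) - X) ≤
      fpChi ((81 / 20 * a) ^ 2) ((27 / 5 * a) ^ 2) (y - P) ^ 2 * (fpSq (y - P))⁻¹ ^ 3 := by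
    intro y hy
    set u : Fin 3 → ℝ := fun k => y k - hcpSite a h z k with hu_def
    have hu : fpSq u ≤ ϱ ^ 2 := by
      rw [hϱ_def, starRad_sq]; exact fpSq_sub_le_of_mem_starCell ha.ne' hh.ne' z ho hv hy
    have hx : (y - P) = d + u := by funext k; simp [hd_def, hu_def, hP]
    rw [hx]
    have hlo := sq_le_fpSq_add hϱ0 hϱR hd hu
    have h275 : (27 / 5 * a) ^ 2 ≤ fpSq (d + u) := le_trans (by nlinarith) hlo
    rw [fpChi_eq_one hS12 h275, one_pow, one_mul]
    have hpos : 0 < fpSq (d + u) := lt_of_lt_of_le (by positivity) h275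
    have := inv_cube_tangent hpos hX
    rw [inv_pow]
    rw [inv_pow, inv_pow] at this
    simpa only [inv_pow] using this
  have hintR : IntegrableOn (fun y : Fin 3 → ℝ => fpChi ((81 / 20 * a) ^ 2) ((27 / 5 * a) ^ 2) (y - P) ^ 2 *
      (fpSq (y - P))⁻¹ ^ 3) (p1RealCell a h T) volume :=
    (continuous_capIntegrand ha _).continuousOn.integrableOn_compact hK
  have hcs : Continuous fun y : Fin 3 → ℝ => fpSq (y - P) := by unfold fpSq; fun_prop
  have hintL : IntegrableOn (fun y : Fin 3 → ℝ => (X⁻¹) ^ 3 - 3 * (X⁻¹) ^ 4 * (fpSq (y - P) - X)) (p1RealCell a h T) volume := by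
    have : Continuous fun y : Fin 3 → ℝ => (X⁻¹) ^ 3 - 3 * (X⁻¹) ^ 4 * (fpSq (y - P) - X) := by fun_prop
    exact this.continuousOn.integrableOn_compact hK
  have hmono := setIntegral_mono_on hintL hintR hmeas hpt
  -- evaluate the left integral
  have hints : IntegrableOn (fun y : Fin 3 → ℝ => fpSq (y - P)) (p1RealCell a h T) volume := hcs.continuousOn.integrableOn_compact hK
  have hvolR : (volume (p1RealCell a h T)).toReal = √3 * a ^ 2 * h / 12 := by
    rw [hvol, ENNReal.toReal_ofReal (by positivity)]
  have hL : ∫ y in p1RealCell a h T, ((X⁻¹) ^ 3 - 3 * (X⁻¹) ^ 4 * (fpSq (y - P) - X)) =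
      √3 * a ^ 2 * h / 12 * (X⁻¹) ^ 3 - 3 * (X⁻¹) ^ 4 * ((∫ y in p1RealCell a h T, fpSq (y - P)) - √3 * a ^ 2 * h / 12 * X) := by
    have e1 : (fun y : Fin 3 → ℝ => (X⁻¹) ^ 3 - 3 * (X⁻¹) ^ 4 * (fpSq (y - P) - X)) =
        fun y => ((X⁻¹) ^ 3 + 3 * (X⁻¹) ^ 4 * X) - (3 * (X⁻¹) ^ 4) * fpSq (y - P) := by funext y; ring
    have hconst : IntegrableOn (fun _ : Fin 3 → ℝ => (X⁻¹) ^ 3 + 3 * (X⁻¹) ^ 4 * X) (p1RealCell a h T) volume := by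
      refine integrableOn_const ?_
      rw [hvol]; exact ENNReal.ofReal_ne_top
    rw [e1, integral_sub hconst (hints.const_mul _),
      integral_const_mul, setIntegral_const, measureReal_def, hvolR, smul_eq_mul]
    ring
  rw [hL] at hmono
  have hJ : (∫ y in p1RealCell a h T, fpChi ((81 / 20 * a) ^ 2) ((27 / 5 * a) ^ 2) (y - P) ^ 2 * (fpSq (y - P))⁻¹ ^ 3) =
      p1CellJ a h p T := rfl
  rw [hJ] at hmono
  -- the second moment against the vertices
  have hsec := setIntegral_fpSq_sub_le ha hh T P
  have hX4 : 0 ≤ 3 * (X⁻¹) ^ 4 := by positivity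
  have hTfst : T.1 = z - o := rfl
  have hTsnd : T.2 = π := rfl
  rw [hTfst, hTsnd] at hsec
  nlinarith [mul_le_mul_of_nonneg_left hsec hX4]

/-! ## The capacity of a loaded leg from the mean vertex second moment of its carriers -/

/-- **JENSEN CAPACITY OF A LEG**: for a leg `(x, d)` with `x` of parity `b` at distance `≥ 27a/5 + ϱ` from `y_p`, and any `X > 0` with
`(|T'|/4)·Σ_{carriers (o,π)} Σ_m |y_{(x−o)+o_m} − y_p|² ≤ n·|T'|·X` (`n = #carriers`, `|T'| = √3a²h/12`): `n·|T'|·X⁻³ ≤ Σ_{T' ∋ (x,d)} J_{T'}`.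
NOT a proof of H12⋆, NOT summit progress. [folklore] -/
theorem cap_ge_carriers_tangent {a h : ℝ} (ha : 0 < a) (hh : 0 < h) (p x d : ℤ × ℤ × ℤ) {b : Bool} (hb : p1Par x = b)
    (hR : 27 / 5 * a + √(4 * a ^ 2 / 3 + h ^ 2) ≤ ‖hcpSite a h x - hcpSite a h p‖) {X : ℝ} (hX : 0 < X)
    (hmom : √3 * a ^ 2 * h / 48 * ∑ oπ ∈ p1Carriers b d, ∑ m' : Fin 4,
        fpSq (fun k => hcpSite a h ((x - oπ.1) + p1VertOff (p1Par (x - oπ.1)) oπ.2 m') k - hcpSite a h p k) ≤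
      ((p1Carriers b d).card : ℝ) * (√3 * a ^ 2 * h / 12) * X) :
    ((p1Carriers b d).card : ℝ) * (√3 * a ^ 2 * h / 12 * (X⁻¹) ^ 3) ≤ p1CapJ a h p (x, d) := by
  set f : (ℤ × ℤ × ℤ) × Fin 6 → (ℤ × ℤ × ℤ) × Fin 6 := fun oπ => (x - oπ.1, oπ.2) with hf
  have hinj : Function.Injective f := by
    intro u v huv
    simp only [hf, Prod.mk.injEq, sub_right_inj] at huv
    exact Prod.ext huv.1 huv.2
  set C := (p1Carriers b d).image f with hC
  have hval := p1Carriers_valid b d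
  have hedge : ∀ T' ∈ C, ((x, d) : (ℤ × ℤ × ℤ) × (ℤ × ℤ × ℤ)) ∈ p1EdgeSet T' := by
    intro T' hT'
    rw [hC, Finset.mem_image] at hT'
    obtain ⟨oπ, hoπ, rfl⟩ := hT'
    obtain ⟨m, m', h1, h2⟩ := hval oπ hoπ
    have hpar : p1Par (x - oπ.1) = parOf b oπ.1 := by rw [p1Par_sub, hb]
    rw [mem_p1EdgeSet_iff]
    refine ⟨m, m', ?_, ?_⟩
    · show x = (x - oπ.1) + p1VertOff (p1Par (x - oπ.1)) oπ.2 m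
      rw [hpar, h1]; abel
    · show x + d = (x - oπ.1) + p1VertOff (p1Par (x - oπ.1)) oπ.2 m'
      rw [hpar, h2]; abel
  set V : ℝ := √3 * a ^ 2 * h / 12 with hV
  set g : (ℤ × ℤ × ℤ) × Fin 6 → ℝ := fun oπ => ∑ m' : Fin 4,
    fpSq (fun k => hcpSite a h ((x - oπ.1) + p1VertOff (p1Par (x - oπ.1)) oπ.2 m') k - hcpSite a h p k) with hg
  -- each carrier: the tangent bound
  have hJ : ∀ oπ ∈ p1Carriers b d, V * (X⁻¹) ^ 3 - 3 * (X⁻¹) ^ 4 * (√3 * a ^ 2 * h / 48 * g oπ - V * X) ≤ p1CellJ a h p (f oπ) := by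
    intro oπ hoπ
    obtain ⟨m, m', h1, _⟩ := hval oπ hoπ
    have hpar : p1Par (x - oπ.1) = parOf b oπ.1 := by rw [p1Par_sub, hb]
    have hvm : p1VertOff (p1Par (x - oπ.1)) oπ.2 m = oπ.1 := by rw [hpar, h1]
    have ho : oπ.1 ∈ p1Corners := h1 ▸ p1VertOff_mem_p1Corners _ _ _
    exact p1CellJ_ge_tangent ha hh p x ho hvm hR hX
  have hsumJ : ∑ oπ ∈ p1Carriers b d, p1CellJ a h p (f oπ) = ∑ T' ∈ C, p1CellJ a h p T' := by
    rw [hC, Finset.sum_image fun u _ v _ huv => hinj huv]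
  have hle1 : ∑ oπ ∈ p1Carriers b d, (V * (X⁻¹) ^ 3 - 3 * (X⁻¹) ^ 4 * (√3 * a ^ 2 * h / 48 * g oπ - V * X)) ≤
      ∑ oπ ∈ p1Carriers b d, p1CellJ a h p (f oπ) := Finset.sum_le_sum hJ
  have hsumL : ∑ oπ ∈ p1Carriers b d, (V * (X⁻¹) ^ 3 - 3 * (X⁻¹) ^ 4 * (√3 * a ^ 2 * h / 48 * g oπ - V * X)) =
      ((p1Carriers b d).card : ℝ) * (V * (X⁻¹) ^ 3) -
        3 * (X⁻¹) ^ 4 * (√3 * a ^ 2 * h / 48 * ∑ oπ ∈ p1Carriers b d, g oπ - ((p1Carriers b d).card : ℝ) * V * X) := by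
    rw [Finset.sum_sub_distrib, Finset.sum_const, nsmul_eq_mul, ← Finset.mul_sum, Finset.sum_sub_distrib, ← Finset.mul_sum,
      Finset.sum_const, nsmul_eq_mul]
    ring
  rw [hsumL, hsumJ] at hle1
  have hcap := sum_le_p1CapJ a h p (x, d) C hedge
  have hX4 : 0 ≤ 3 * (X⁻¹) ^ 4 := by positivity
  have hmom' : √3 * a ^ 2 * h / 48 * ∑ oπ ∈ p1Carriers b d, g oπ - ((p1Carriers b d).card : ℝ) * V * X ≤ 0 := by
    linarith
  nlinarith [mul_nonpos_iff.2 (Or.inl ⟨hX4, hmom'⟩)]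

end Summit.AtomisticToContinuum.Crystallization.Theorems.StrictSplittingRuleBirth

end
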